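import Literature.NumberTheory.EllipticCurves.LocalTatePairingKummerTadic
import Literature.NumberTheory.EllipticCurves.VariableChangePointsMap
import Literature.NumberTheory.EllipticCurves.PadicLogFiniteExtensionVariableChangeProofs
import Literature.NumberTheory.EllipticCurves.PadicLogFiniteExtensionLocalFieldProofs
import HarnessLib

/-!
# The transport data of an admissible change of variables: geometric points, Tate modules, rational points, and `log_ω`

Topic `Literature/NumberTheory/EllipticCurves`; THEOREMS ONLY (no definition, no named fact, no instance, no `sorry`). For a Weierstrass
equation `V` over a field `F`, an admissible change of variables `C = (u, r, s, t)` over `F` and ANY equation `X` EQUAL to `C • V` (`hC`), the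
substitution `ι_C` yields, packaged existentially (no new definition):

* ★ `exists_transportData_of_variableChange` — a `Γ_F`-EQUIVARIANT isomorphism of geometric points `φ : V(F̄) ≃ X(F̄)` (tree
  `VariableChange.pointEquivBaseChange` + `pointEquivBaseChange_map_algEquiv`), its Tate-module map `T_p(φ) : T_pV ≃ T_pX` with components
  `(T_p(φ) a)_n = φ(a_n)` (`TateModule.mapEquivOfTorsion`), and the `F`-rational substitution `φ_F : V(F) → X(F)` UNDER `φ`
  (`φ(ι P) = ι(φ_F P)`, `pointEquivBaseChange_map`) with `φ_F P = ι_C P` read in `X` (`Affine.Point.congrEquiv hC`).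
  These are exactly the hypotheses `(φ, hφ, Tφ, hTφ, φ_F, hφF)` of the transport bricks `PAdicHodge/TatePairingPointOfKTwoTransport`,
  `PAdicHodge/BmaxPlusTransportedReciprocityTransport` and of `Summits/…/…TransportedReciprocityTransport` (Kato's explicit reciprocity law for a curve
  ISOMORPHIC over `K_v` to a good model).
* ★ `padicLogPointFiniteExt_congrEquiv_pointMap_of_isNonarchimedeanLocalField` — over a non-archimedean local field, for `|u| ≤ 1` and both models
  integral: **`log_ω^X(φ_F P) = u · log_ω^V(P)` for EVERY `P ∈ V(F)`** (`padicLogPointFiniteExt_pointMap_of_variableChange` with its (SPEC) and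
  level-multiple side conditions discharged by completeness / the finite residue field) — the hypothesis `hlogφ` of
  `…TransportedReciprocityTransport.exists_const_tatePairingPoint_eq_trace_mul_padicLog_transport_of_log_eq`; *AEC* III.1 Table 3.1, `u⁻¹ω' = ω`.

Purpose: crux K★ `stmt-BirchSwinnertonDyer-22226` (route `EdixhovenFibreFiveSeven`, line `kato_lever`): with these two theorems a K★ cell proves Kato's
formula for `W_min ⊗ ℚ_p(ζ_m)_w(ϖ)` from the good `𝒪_D`-model by exhibiting ONE change of variables `C` with `C • (W_min ⊗ F) = curveFO F (W_D ⊗_ψ 𝒪_F)`.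
Infrastructure only; BSD / K★ are not proved by any of this.

## References
* J. H. Silverman, *The Arithmetic of Elliptic Curves* (2009), III.1 (Table 3.1), Prop. III.3.1(b), III §7, Thm. IV.6.4, Prop. VII.2.2, VIII §1, X §4.
  [SilvermanAEC2009]
-/

noncomputable section

open scoped Classical NNReal

namespace Literature.NumberTheory.EllipticCurves

open _root_.WeierstrassCurve _root_.WeierstrassCurve.VariableChange Field ValuativeRel FormalGroupChart

/-! ## §1 Geometric points, Tate modules and rational points under `ι_C` -/

section Data

variable {F : Type} [Field F] (V : WeierstrassCurve F) (C : VariableChange F) {X : WeierstrassCurve F} (p : ℕ) [Fact p.Prime]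

/-- ★ **The transport data of a change of variables.** For `X = C • V` (`hC`): an isomorphism of `Γ_F`-modules `φ : V(F̄) ≃ X(F̄)`, its Tate-module
map `T_p(φ)` (components `φ`), and the `F`-rational substitution `φ_F` under it, `φ_F P = ι_C P` read in `X` along `hC`.
[cite: SilvermanAEC2009, Prop. III.3.1(b), III §7, VIII §1, X §4] -/
theorem exists_transportData_of_variableChange (hC : C • V = X) :
    ∃ (φ : geomPoints V ≃+ geomPoints X) (Tφ : V.tateModule p ≃ₗ[ℤ_[p]] X.tateModule p)
      (φF : (V.baseChange F).toAffine.Point →+ (X.baseChange F).toAffine.Point),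
      (∀ (σ : absoluteGaloisGroup F) (P : geomPoints V), φ (σ • P) = σ • φ P) ∧
      (∀ (a : V.tateModule p) (n : ℕ), TateModule.proj p n (Tφ a) = φ (TateModule.proj p n a)) ∧
      (∀ P, φ (toGeomPoints V P) = toGeomPoints X (φF P)) ∧
      (∀ P : V.toAffine.Point, φF P = Affine.Point.congrEquiv hC (pointMap V C P)) := by
  subst hC
  -- `φ` = the substitution with coefficients viewed in `F̄`, `φ_F` = the substitution over `F`
  refine ⟨pointEquivBaseChange V C (AlgebraicClosure F),
    TateModule.mapEquivOfTorsion (pointEquivBaseChange V C (AlgebraicClosure F)).toAddMonoidHom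
      (pointEquivBaseChange V C (AlgebraicClosure F)).injective
      (fun _ b _ => ⟨(pointEquivBaseChange V C (AlgebraicClosure F)).symm b, (pointEquivBaseChange V C (AlgebraicClosure F)).apply_symm_apply b⟩),
    (pointEquivBaseChange V C F).toAddMonoidHom, fun σ P => ?_, fun a n => rfl, fun P => ?_, fun P => ?_⟩
  · -- equivariance: `σ • P = P^σ` on coordinates
    set σ' : AlgebraicClosure F ≃ₐ[F] AlgebraicClosure F := σ
    change pointEquivBaseChange V C (AlgebraicClosure F) (Affine.Point.map (σ' : AlgebraicClosure F →ₐ[F] AlgebraicClosure F) P) =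
      Affine.Point.map (σ' : AlgebraicClosure F →ₐ[F] AlgebraicClosure F) (pointEquivBaseChange V C (AlgebraicClosure F) P)
    exact pointEquivBaseChange_map_algEquiv V C σ' P
  · -- `φ(ι P) = ι(φ_F P)`: functoriality of the substitution in the field of the points
    exact (pointEquivBaseChange_map V C (Algebra.ofId F (AlgebraicClosure F)) P).symm
  · -- `φ_F P = ι_C P`: the substitution over `F` itself (`C.map (algebraMap F F) = C`)
    rcases P with _ | ⟨x, y, h⟩
    · rfl
    · change pointEquivBaseChange V C F (.some x y h) = _
      rw [pointEquivBaseChange_some]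
      have hCF : C.map (algebraMap F F) = C := by rw [Algebra.algebraMap_self, VariableChange.map_id]
      simp only [hCF, pointMap, Affine.Point.congrEquiv_some]
      rfl

end Data

/-! ## §2 `log_ω` under `φ_F` over a non-archimedean local field -/

section Log

variable {F : Type} [Field F] [ValuativeRel F] [TopologicalSpace F] [IsNonarchimedeanLocalField F] [CharZero F]
  (V : WeierstrassCurve F) [V.IsElliptic] (C : VariableChange F) {X : WeierstrassCurve F}
  (w : Valuation F ℝ≥0) [w.Compatible] [V.IsIntegral w.integer] [X.IsIntegral w.integer] {p : ℕ} [Fact p.Prime]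

/-- ★ **`log_ω^X(ι_C P) = u · log_ω^V(P)` for EVERY `P ∈ V(F)` over a non-archimedean local field** (`X = C • V`, `|u| ≤ 1`, both models
`w`-integral): `padicLogPointFiniteExt_pointMap_of_variableChange` with (SPEC) from completeness (`limitLog_spec_of_isNonarchimedeanLocalField`) and
the level multiple from the finite residue field (`exists_nsmul_mem_level_of_isNonarchimedeanLocalField`), read in `X` along `hC`
(`padicLogPointFiniteExt_congrEquiv`). [cite: SilvermanAEC2009, III.1 Table 3.1 and Thm. IV.6.4] -/
theorem padicLogPointFiniteExt_congrEquiv_pointMap_of_isNonarchimedeanLocalField (hC : C • V = X) (hp : valuation F (p : F) < 1)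
    (hu : w (C.u : F) ≤ 1) (P : V.toAffine.Point) :
    padicLogPointFiniteExt w X p (Affine.Point.congrEquiv hC (pointMap V C P)) = (C.u : F) * padicLogPointFiniteExt w V p P := by
  subst hC
  have hp0 : (p : F) ≠ 0 := Nat.cast_ne_zero.2 (Fact.out : p.Prime).ne_zero
  have hpw : w (p : F) < 1 := (ValuativeRel.isEquiv w (valuation F)).lt_one_iff_lt_one.mpr hp
  obtain ⟨m, hm, hmP⟩ := exists_nsmul_mem_level_of_isNonarchimedeanLocalField V w hp0 P
  rw [padicLogPointFiniteExt_congrEquiv rfl]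
  exact padicLogPointFiniteExt_pointMap_of_variableChange hp0 hpw hu (limitLog_spec_of_isNonarchimedeanLocalField V w hp0 hp)
    (limitLog_spec_of_isNonarchimedeanLocalField (C • V) w hp0 hp) hm hmP

end Log

/-! ## §3 Reading a change of variables given over an intermediate field at a further extension -/

section Tower

variable {K₀ K L : Type} [Field K₀] [Field K] [Field L] [Algebra K₀ K] [Algebra K L] [Algebra K₀ L] [IsScalarTower K₀ K L]
  (W : WeierstrassCurve K₀) (C : VariableChange K)

/-- `(W ⊗ K) ⊗ L = W ⊗ L` along a tower `K₀ ⊆ K ⊆ L` (Mathlib `map_baseChange` at `IsScalarTower.toAlgHom`; any `K₀`).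
[cite: SilvermanAEC2009, III.1] -/
theorem baseChange_baseChange_of_isScalarTower : (W.baseChange K).baseChange L = W.baseChange L :=
  W.map_baseChange (IsScalarTower.toAlgHom K₀ K L)

/-- ★ **A change of variables over `K` read at `L ⊇ K`**: if `C • (W ⊗ K) = S` over `K` and `S ⊗ L = X`, then
`C_L • (W ⊗ L) = X` with `C_L = C.map (algebraMap K L)` — the hypothesis `hC` of the transport theorems at the completion `L = K_{v′}` from the
global change of variables `C` over the number field `K` (`S = C • W_min ⊗ K` the `K`-model, `S ⊗ K_{v′}` = the good model read in `K_{v′}`).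
[cite: SilvermanAEC2009, III.1 Table 3.1] -/
theorem map_smul_baseChange_eq_of_smul_eq {S : WeierstrassCurve K} (hS : C • W.baseChange K = S) {X : WeierstrassCurve L}
    (hX : S.baseChange L = X) : C.map (algebraMap K L) • W.baseChange L = X := by
  rw [← hX, ← hS, VariableChange.baseChange_smul_eq, baseChange_baseChange_of_isScalarTower]

end Tower

end Literature.NumberTheory.EllipticCurves

end
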